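import Summits.ResolutionOfSingularities.ResolutionOfSingularities.Theorems.WeightedInvariantIota3DominanceWord
import HarnessLib

/-!
# (PRES)₃ at the POINT positions with `ε = 0` — the σ-presentation (σ-pres)₃, now a theorem, in the binder shape of the gap list
# (door `HypersurfaceCentreConstruction`, stmt-ResolutionOfSingularities-19897; memo CLOSURES.md §3)

Helper for `stub_keyRungGrHomLE_three` (def-free, `--supports 19897`).  The hypothesis (PRES)₃ of `keyRungGrHomLE_three_of_pres_drop`
(…KeyRungThreeOfPresDrop) asks, at the canonical centre `P` of a door position `(S, f)`, for a weighted regular system of parameters presenting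
`(P, J₃ᵗ)`.  At the positions of Krull dimension `3` whose top `ι₀`-stratum is the closed point (`P = 𝔪`) and `ε = 0` (ISOLATED / TIE) this is
exactly (σ-pres)₃ `SigmaPresentationLE3Body p`, a theorem since …Iota3DominanceWord (`sigmaPresentationLE3Body_holds`):
**`pres3_of_centre_eq_maximalIdeal_of_eps_zero`**.  The remaining regimes of (PRES)₃ are: `P = 𝔪`, `ε = 1` (CROSSING, `J₃ᵗ = jContact`),
`dim S ⧸ P = 1` (the CURVE regime: the cylinder over `S_P`, `comap_map_weightedMonomialIdeal_append_zero`), and `dim S ≤ 2`.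
[OURS · L1 W4.3 · audit glue; AI work, weaker than expert review; nothing here is a statement of the manuscript under review.]
-/

noncomputable section

set_option linter.dupNamespace false -- mandated namespace of this single-conjunct summit

open IsLocalRing Literature.AlgebraicGeometry.Resolution
open Summit.ResolutionOfSingularities.ResolutionOfSingularities.Theorems
open Summit.ResolutionOfSingularities.ResolutionOfSingularities.Theorems.ContactCylinder

namespace Summit.ResolutionOfSingularities.ResolutionOfSingularities.Cruxes.HypersurfaceCentreConstruction.LocalEngine

open Iota3

/-- **(PRES)₃ AT THE `ε = 0` POINT POSITIONS.**  `S` regular local of Krull dimension `3`, essentially of finite type over a perfect field of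
characteristic `p`, `0 ≠ f ∈ 𝔪²`, top `ι₀`-stratum `= {𝔪}`, `ε(S, f) = 0`: there is a regular system of parameters `u` with POSITIVE weights `w`
such that `span {u_i : w_i > 0} = 𝔪` and `weightedMonomialIdeal u w m = J₃ᵗ S f m` for all `m` ((σ-pres)₃ `sigmaPresentationLE3Body_holds`).
[OURS · L1 W4.3] -/
theorem pres3_of_centre_eq_maximalIdeal_of_eps_zero (p : ℕ) (k₀ : Type) [Field k₀] [CharP k₀ p] [PerfectField k₀]
    (S : Type) [CommRing S] [Algebra k₀ S] [Algebra.EssFiniteType k₀ S] [IsRegularLocalRing S] (f : S)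
    (hdim : ringKrullDim S = (3 : ℕ)) (hf0 : f ≠ 0) (hf2 : f ∈ (maximalIdeal S) ^ 2)
    (hE : topStratum iotaOrdEpsTau S f = {𝔮 | maximalIdeal S ≤ 𝔮.asIdeal}) (hε : iotaEps S f = 0) :
    ∃ (n : ℕ) (u : Fin n → S) (w : Fin n → ℕ),
      Ideal.span (Set.range u) = maximalIdeal S ∧ (maximalIdeal S).spanFinrank = n ∧ (∃ i, 0 < w i) ∧
      Ideal.span {x | ∃ i, 0 < w i ∧ x = u i} = maximalIdeal S ∧
      (∀ m : ℕ, weightedMonomialIdeal u w m = jFlatT S f m) := by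
  have htop : topStratumPrime iotaOrdEpsTau S f = maximalIdeal S := topStratumPrime_eq_of_topStratum_eq iotaOrdEpsTau S f hE
  obtain ⟨n, u, w, h1, h2, h3, h4⟩ := sigmaPresentationLE3Body_holds p k₀ S f hdim hf0 hf2 htop hε
  have hset : {x | ∃ i, 0 < w i ∧ x = u i} = Set.range u := by
    ext x
    exact ⟨fun ⟨i, _, hx⟩ => ⟨i, hx.symm⟩, fun ⟨i, hx⟩ => ⟨i, h3 i, hx.symm⟩⟩
  have hn : 0 < n := by
    rcases Nat.eq_zero_or_pos n with h0 | hpos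
    · exfalso
      subst h0
      have hbot : maximalIdeal S = ⊥ := by
        rw [← h1, Ideal.span_eq_bot]
        rintro x ⟨i, -⟩
        exact i.elim0
      apply hf0
      have : f ∈ (⊥ : Ideal S) := by
        have h := hf2
        rw [hbot, ← Ideal.zero_eq_bot, zero_pow two_ne_zero] at h
        exact h
      exact (Ideal.mem_bot).mp this
    · exact hpos
  exact ⟨n, u, w, h1, h2, ⟨⟨0, hn⟩, h3 _⟩, by rw [hset, h1], h4⟩

end Summit.ResolutionOfSingularities.ResolutionOfSingularities.Cruxes.HypersurfaceCentreConstruction.LocalEngine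

end
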